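import Literature.Analysis.FluidPDE.PassiveScalarForcedClass

/-!
# Route TwoAndHalfD (AnomalousDissipation) — helpers for `SourcedScalarUnique2D` (I)

Support lemmas for stmt-AnomalousDissipation-14323 (`SourcedScalarUnique2D`, uniqueness of
`L^∞_t L²_x` weak sourced passive scalars over a Leray–Hopf drift):

* `isWeakScalarTransportOn_sub` — the difference `θ₁ - θ₂` of two weak solutions of the SOURCED
  equation `∂ₜθ + u·∇θ = κΔθ + s` (`Torus.IsWeakScalarTransportForcedOn`) with the same datum and
  source is a weak solution of the homogeneous equation (`Torus.IsWeakScalarTransportOn`) with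
  datum `0` (linearity of the distributional formulation; DiPerna–Lions 1989, §II.1);
* the class bookkeeping it needs: `lintegral_mul_sub_lt_top` (`‖u‖(θ₁-θ₂) ∈ L¹`) and
  `ae_lintegral_sq_sub_le` (`θ₁ - θ₂ ∈ L^∞_t L²_x`).

## References

* R. J. DiPerna, P.-L. Lions, Invent. Math. 98 (1989), §II.1–II.3. [`DiPernaLions1989`]
-/

noncomputable section

open MeasureTheory Set Filter Function TopologicalSpace
open scoped ENNReal NNReal InnerProductSpace

namespace Summit.AnomalousDissipation.AnomalousDissipation.Theorems

-- D-0017: single-problem summit ⇒ `Summit.AnomalousDissipation.AnomalousDissipation.…` by design.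
set_option linter.dupNamespace false

open Literature.Analysis Literature.Analysis.FluidPDE Literature.Analysis.FluidPDE.Torus

variable {d : Type*} [Fintype d]

/-! ## The difference of two sourced weak solutions -/

section Difference

variable {T κ : ℝ} {u : ℝ → UnitAddTorus d → EuclideanSpace ℝ d} {s : ℝ → UnitAddTorus d → ℝ}
  {θ₀ : UnitAddTorus d → ℝ} {θ₁ θ₂ : ℝ → UnitAddTorus d → ℝ}

/-- `‖u‖ (θ₁ - θ₂) ∈ L¹((0,T) × T^d)` in the iterated-`lintegral` form of the solution class. [folklore] -/
theorem lintegral_mul_sub_lt_top (h₁ : IsWeakScalarTransportForcedOn T κ u s θ₀ θ₁)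
    (h₂ : IsWeakScalarTransportForcedOn T κ u s θ₀ θ₂) :
    ∫⁻ t in Ioo 0 T, ∫⁻ x, ‖u t x‖ₑ * ‖θ₁ t x - θ₂ t x‖ₑ < ⊤ := by
  set μT : Measure ℝ := (volume : Measure ℝ).restrict (Ioo 0 T) with hμT
  have hmu := h₁.aestronglyMeasurable_uncurry_velocity
  have hm₁ := h₁.aestronglyMeasurable_uncurry
  have hm₂ := h₂.aestronglyMeasurable_uncurry
  have hF : AEMeasurable (fun p : ℝ × UnitAddTorus d => ‖u p.1 p.2‖ₑ * ‖θ₁ p.1 p.2 - θ₂ p.1 p.2‖ₑ)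
      (μT.prod volume) := hmu.enorm.mul (hm₁.sub hm₂).enorm
  have hF₁ : AEMeasurable (fun p : ℝ × UnitAddTorus d => ‖u p.1 p.2‖ₑ * ‖θ₁ p.1 p.2‖ₑ) (μT.prod volume) :=
    hmu.enorm.mul hm₁.enorm
  have hF₂ : AEMeasurable (fun p : ℝ × UnitAddTorus d => ‖u p.1 p.2‖ₑ * ‖θ₂ p.1 p.2‖ₑ) (μT.prod volume) :=
    hmu.enorm.mul hm₂.enorm
  have e : ∫⁻ t in Ioo 0 T, ∫⁻ x, ‖u t x‖ₑ * ‖θ₁ t x - θ₂ t x‖ₑ =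
      ∫⁻ p, ‖u p.1 p.2‖ₑ * ‖θ₁ p.1 p.2 - θ₂ p.1 p.2‖ₑ ∂(μT.prod volume) := (lintegral_prod _ hF).symm
  rw [e]
  calc ∫⁻ p, ‖u p.1 p.2‖ₑ * ‖θ₁ p.1 p.2 - θ₂ p.1 p.2‖ₑ ∂(μT.prod volume)
      ≤ ∫⁻ p, (‖u p.1 p.2‖ₑ * ‖θ₁ p.1 p.2‖ₑ + ‖u p.1 p.2‖ₑ * ‖θ₂ p.1 p.2‖ₑ) ∂(μT.prod volume) := by
        refine lintegral_mono fun p => ?_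
        rw [← mul_add]
        gcongr
        exact enorm_sub_le
    _ = (∫⁻ p, ‖u p.1 p.2‖ₑ * ‖θ₁ p.1 p.2‖ₑ ∂(μT.prod volume)) +
          ∫⁻ p, ‖u p.1 p.2‖ₑ * ‖θ₂ p.1 p.2‖ₑ ∂(μT.prod volume) := lintegral_add_left' hF₁ _
    _ = (∫⁻ t in Ioo 0 T, ∫⁻ x, ‖u t x‖ₑ * ‖θ₁ t x‖ₑ) + ∫⁻ t in Ioo 0 T, ∫⁻ x, ‖u t x‖ₑ * ‖θ₂ t x‖ₑ := by
        rw [lintegral_prod _ hF₁, lintegral_prod _ hF₂]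
    _ < ⊤ := ENNReal.add_lt_top.2 ⟨h₁.lintegral_mul_lt_top, h₂.lintegral_mul_lt_top⟩

/-- `θ₁ - θ₂ ∈ L^∞(0,T; L²)`: `∫ |θ₁(t) - θ₂(t)|² ≤ (C₁ + C₂)²` for a.e. `t`. [folklore] -/
theorem ae_lintegral_sq_sub_le (h₁ : IsWeakScalarTransportForcedOn T κ u s θ₀ θ₁)
    (h₂ : IsWeakScalarTransportForcedOn T κ u s θ₀ θ₂) :
    ∃ C : ℝ≥0, ∀ᵐ t ∂(volume.restrict (Ioo 0 T)), ∫⁻ x, ‖θ₁ t x - θ₂ t x‖ₑ ^ 2 ≤ C := by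
  obtain ⟨C₁, hC₁⟩ := h₁.exists_eLpNorm_le
  obtain ⟨C₂, hC₂⟩ := h₂.exists_eLpNorm_le
  refine ⟨(C₁ + C₂) ^ 2, ?_⟩
  filter_upwards [hC₁, hC₂, h₁.ae_memLp_two, h₂.ae_memLp_two] with t hc₁ hc₂ hm₁ hm₂
  have hsub : eLpNorm (θ₁ t - θ₂ t) 2 volume ≤ C₁ + C₂ :=
    (eLpNorm_sub_le hm₁.1 hm₂.1 one_le_two).trans (add_le_add hc₁ hc₂)
  have e : ∫⁻ x, ‖θ₁ t x - θ₂ t x‖ₑ ^ 2 = eLpNorm (θ₁ t - θ₂ t) 2 volume ^ 2 := by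
    rw [PassiveScalarProofs.eLpNorm_two_pow_two]
    rfl
  rw [e, ENNReal.coe_pow, ENNReal.coe_add]
  exact pow_le_pow_left' hsub 2

/-- **The difference of two sourced weak solutions with the same datum and source is a weak
solution of the homogeneous passive scalar equation with datum `0`** (linearity of the
distributional formulation `∫∫ θ(∂ₜψ + u·∇ψ + κΔψ) + ∫∫ sψ + ∫ θ₀ψ(0) = 0`: the source and datum
terms cancel; the class conditions `L^∞_t L²_x`, `uθ ∈ L¹` pass to differences)
(DiPerna–Lions 1989, §II.1). [cite: DiPernaLions1989, §II.1] -/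
theorem isWeakScalarTransportOn_sub (h₁ : IsWeakScalarTransportForcedOn T κ u s θ₀ θ₁)
    (h₂ : IsWeakScalarTransportForcedOn T κ u s θ₀ θ₂) :
    IsWeakScalarTransportOn T κ u 0 (fun t x => θ₁ t x - θ₂ t x) where
  aestronglyMeasurable := by
    have := h₁.aestronglyMeasurable.sub h₂.aestronglyMeasurable
    exact this
  aestronglyMeasurable_velocity := h₁.aestronglyMeasurable_velocity
  ae_lintegral_sq_le := ae_lintegral_sq_sub_le h₁ h₂
  lintegral_velocity_lt_top := h₁.lintegral_velocity_lt_top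
  lintegral_mul_lt_top := lintegral_mul_sub_lt_top h₁ h₂
  ae_isWeaklyDivFree := h₁.ae_isWeaklyDivFree
  weak_eq ψ hψ := by
    have e₁ := h₁.weak_eq ψ hψ
    have e₂ := h₂.weak_eq ψ hψ
    have hI₁ := h₁.integrable_weakIntegrand hψ
    have hI₂ := h₂.integrable_weakIntegrand hψ
    have hslice : ∀ᵐ t ∂(volume.restrict (Ioo 0 T)),
        ∫ x, (θ₁ t x - θ₂ t x) * (FunctionSpaces.Torus.timeDeriv ψ t x +
          ⟪u t x, FunctionSpaces.Torus.gradient (ψ t) x⟫_ℝ + κ * FunctionSpaces.Torus.laplacian (ψ t) x) =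
        (∫ x, θ₁ t x * (FunctionSpaces.Torus.timeDeriv ψ t x +
          ⟪u t x, FunctionSpaces.Torus.gradient (ψ t) x⟫_ℝ + κ * FunctionSpaces.Torus.laplacian (ψ t) x)) -
        ∫ x, θ₂ t x * (FunctionSpaces.Torus.timeDeriv ψ t x +
          ⟪u t x, FunctionSpaces.Torus.gradient (ψ t) x⟫_ℝ + κ * FunctionSpaces.Torus.laplacian (ψ t) x) := by
      filter_upwards [hI₁.prod_right_ae, hI₂.prod_right_ae] with t ht₁ ht₂
      rw [← integral_sub ht₁ ht₂]
      refine integral_congr_ae (Eventually.of_forall fun x => ?_)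
      dsimp only
      ring
    rw [integral_congr_ae hslice, integral_sub hI₁.integral_prod_left hI₂.integral_prod_left]
    simp only [Pi.zero_apply, zero_mul, integral_zero, add_zero]
    linarith
    
end Difference

end Summit.AnomalousDissipation.AnomalousDissipation.Theorems

end
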